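import Literature.NumberTheory.PAdicHodge.FontaineThetaField
import Literature.AlgebraicGeometry.Resolution.AdicQuotient
import Mathlib.RingTheory.DiscreteValuationRing.Basic
import HarnessLib

/-!
# `B_dR⁺(F)` is a complete discrete valuation ring with uniformizer `ξ`

**General principle** (Fontaine 1994, Exp. II §1.5.2; Fontaine–Ouyang Prop. 5.1.4 — the argument
given there for `B_dR⁺`): if `A` is a domain and `ξ ∈ A` is a nonzero element generating a
*maximal* ideal `I = (ξ)`, then the `I`-adic completion `Â = lim A/ξⁿ` is a discrete valuation
ring with uniformizer (the image of) `ξ`: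

* `PrincipalCompletion.mem_map_pow_iff` : `x ∈ ξⁿÂ ↔ x ≡ 0 mod ξⁿ` (Mathlib: kernels of the
  evaluations of an adic completion at a finitely generated ideal);
* `PrincipalCompletion.eq_zero_of_xi_mul_eq_zero` : `ξ` is a non-zero-divisor of `Â`;
* `PrincipalCompletion.exists_eq_pow_mul` : every `x ≠ 0` is `ξⁿ · unit`;
* `PrincipalCompletion.isDomain`, `PrincipalCompletion.irreducible_xiHat`,
  `PrincipalCompletion.isDiscreteValuationRing`.

(The ideal is a parameter `I` with `hI : I = (ξ)`, so that the results apply verbatim to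
`I = ker θ[1/p]`.)

**Application** (`A = 𝔸_inf(F)[1/p]`, `ξ = [p♭] − p`, `ker θ[1/p] = (ξ)` maximal, file
`FontaineThetaField`): `B_dR⁺(F)` is a domain and a discrete valuation ring
(`isDomain_bDeRhamPlus`, `isDiscreteValuationRing_bDeRhamPlus`; instances `instIsDomainBdRPlus`,
`instIsDiscreteValuationRingBdRPlus` for `BdRPlus F hp`), every nonzero element is `ξⁿ·unit`
(`exists_eq_xi_pow_mul_bDeRhamPlus`).

## References
* [FontaineAsterisque223III] J.-M. Fontaine, *Le corps des périodes p-adiques*, Astérisque 223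
  (1994), Exp. II, §1.5.2.
* [FontaineOuyang2022] J.-M. Fontaine, Y. Ouyang, *Theory of p-adic Galois representations*
  (book draft), Prop. 5.1.4.
-/

noncomputable section

open Ideal
open Literature.AlgebraicGeometry.Resolution

namespace Literature.NumberTheory.PAdicHodge

/-! ### The completion of a domain at a principal maximal ideal -/

namespace PrincipalCompletion

variable {A : Type*} [CommRing A] {I : Ideal A} {ξ : A}

variable (I ξ) in
/-- The image of `ξ` in the completion `Â = A^_I`. [folklore] -/
abbrev xiHat : AdicCompletion I A := AdicCompletion.of I A ξ

/-- The extended ideal `I Â` is generated by the image of `ξ`. [folklore] -/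
theorem map_eq_span (hI : I = Ideal.span {ξ}) :
    I.map (algebraMap A (AdicCompletion I A)) = Ideal.span {xiHat I ξ} := by
  rw [hI, Ideal.map_span, Set.image_singleton]; rfl

/-- **`x ∈ IⁿÂ ↔ evalₙ x = 0`** (`Â → A/Iⁿ`): the kernel of the `n`-th evaluation of the adic
completion at a finitely generated ideal (Mathlib `AdicCompletion.pow_smul_top_eq_ker_eval`).
[folklore] -/
theorem mem_map_pow_iff (hfg : I.FG) (x : AdicCompletion I A) (n : ℕ) :
    x ∈ (I.map (algebraMap A (AdicCompletion I A))) ^ n ↔ AdicCompletion.evalₐ I n x = 0 := by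
  have h1 : x ∈ (I.map (algebraMap A (AdicCompletion I A))) ^ n ↔
      x ∈ (I ^ n • ⊤ : Submodule A (AdicCompletion I A)) := by
    rw [Ideal.smul_top_eq_map, Submodule.restrictScalars_mem, Ideal.map_pow]
  rw [h1, AdicCompletion.pow_smul_top_eq_ker_eval hfg, LinearMap.mem_ker]
  have hle : I ^ n ≤ (I ^ n • ⊤ : Ideal A) := by rw [smul_eq_mul, Ideal.mul_top]
  rw [← AdicCompletion.factor_evalₐ_eq_eval I x hle]
  obtain ⟨s, hs⟩ := Ideal.Quotient.mk_surjective (AdicCompletion.evalₐ I n x)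
  rw [← hs, Ideal.Quotient.factor_mk, Ideal.Quotient.eq_zero_iff_mem, Ideal.Quotient.eq_zero_iff_mem,
    smul_eq_mul, Ideal.mul_top]

/-- `evalₙ x = 0 ↔ x = ξⁿ y` for some `y`. [folklore] -/
theorem evalₐ_eq_zero_iff (hI : I = Ideal.span {ξ}) (x : AdicCompletion I A) (n : ℕ) :
    AdicCompletion.evalₐ I n x = 0 ↔ ∃ y, x = xiHat I ξ ^ n * y := by
  rw [← mem_map_pow_iff (hI ▸ fg_span_singleton ξ), map_eq_span hI, Ideal.span_singleton_pow, Ideal.mem_span_singleton']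
  exact ⟨fun ⟨y, hy⟩ => ⟨y, by rw [← hy, mul_comm]⟩, fun ⟨y, hy⟩ => ⟨y, by rw [hy, mul_comm]⟩⟩

/-- `evalₐ 0` is the zero map (`A/I⁰ = 0`). [folklore] -/
theorem evalₐ_zero_eq (x : AdicCompletion I A) : AdicCompletion.evalₐ I 0 x = 0 := by
  obtain ⟨t, ht⟩ := Ideal.Quotient.mk_surjective (AdicCompletion.evalₐ I 0 x)
  rw [← ht, Ideal.Quotient.eq_zero_iff_mem, pow_zero, Ideal.one_eq_top]; exact Submodule.mem_top

variable [IsDomain A]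

/-- In a domain, `ξ t ∈ (ξ^(n+1))` forces `t ∈ (ξⁿ)` (`ξ ≠ 0`). [folklore] -/
theorem mem_span_pow_of_mul_mem (hξ : ξ ≠ 0) {t : A} {n : ℕ} (h : ξ * t ∈ (Ideal.span {ξ} : Ideal A) ^ (n + 1)) :
    t ∈ (Ideal.span {ξ} : Ideal A) ^ n := by
  rw [Ideal.span_singleton_pow, Ideal.mem_span_singleton'] at h ⊢
  obtain ⟨s, hs⟩ := h
  refine ⟨s, mul_left_cancel₀ hξ ?_⟩
  rw [← hs]; ring

/-- **`ξ` is a non-zero-divisor of `Â`.** [cite: FontaineOuyang2022, Prop. 5.1.4] -/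
theorem eq_zero_of_xi_mul_eq_zero (hI : I = Ideal.span {ξ}) (hξ : ξ ≠ 0) {x : AdicCompletion I A}
    (h : xiHat I ξ * x = 0) : x = 0 := by
  subst hI
  refine AdicCompletion.ext_evalₐ fun n => ?_
  rw [_root_.map_zero]
  obtain ⟨t, ht⟩ := Ideal.Quotient.mk_surjective (AdicCompletion.evalₐ (Ideal.span {ξ}) (n + 1) x)
  have h1 : AdicCompletion.evalₐ (Ideal.span {ξ}) (n + 1) (xiHat (Ideal.span {ξ}) ξ * x) = 0 := by rw [h, _root_.map_zero]
  rw [map_mul, ← ht, xiHat, AdicCompletion.evalₐ_of, ← map_mul, Ideal.Quotient.eq_zero_iff_mem] at h1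
  rw [← factorPow_evalₐ (Ideal.span {ξ}) (Nat.le_succ n) x, ← ht, Ideal.Quotient.factorPow,
    Ideal.Quotient.factor_mk, Ideal.Quotient.eq_zero_iff_mem]
  exact mem_span_pow_of_mul_mem hξ h1

/-- Powers of `ξ` are non-zero-divisors of `Â`. [folklore] -/
theorem eq_zero_of_xi_pow_mul_eq_zero (hI : I = Ideal.span {ξ}) (hξ : ξ ≠ 0) (n : ℕ) {x : AdicCompletion I A}
    (h : xiHat I ξ ^ n * x = 0) : x = 0 := by
  induction n with
  | zero => rwa [pow_zero, one_mul] at h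
  | succ n ih => rw [pow_succ', mul_assoc] at h; exact ih (eq_zero_of_xi_mul_eq_zero hI hξ h)

section Maximal

variable (hI : I = Ideal.span {ξ}) [hmax : I.IsMaximal]
include hI

omit [IsDomain A] in
/-- `I Â` is maximal. [folklore] -/
theorem isMaximal_map : (I.map (algebraMap A (AdicCompletion I A))).IsMaximal :=
  haveI := hmax
  AdicCompletion.isMaximal_map_of_le _ _ le_rfl (hI ▸ fg_span_singleton ξ)

omit [IsDomain A] hmax in
/-- `Â` is `I Â`-adically complete. [folklore] -/
theorem isAdicComplete_map : IsAdicComplete (I.map (algebraMap A (AdicCompletion I A))) (AdicCompletion I A) :=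
  AdicCompletion.isAdicComplete_self _ (hI ▸ fg_span_singleton ξ)

omit [IsDomain A] in
/-- **`Â` is a local ring** with maximal ideal `I Â = ξÂ`. [cite: FontaineOuyang2022, Prop. 5.1.4] -/
theorem isLocalRing : IsLocalRing (AdicCompletion I A) :=
  haveI := isMaximal_map hI
  haveI := isAdicComplete_map (A := A) hI
  isLocalRing_of_isAdicComplete_maximal (I.map (algebraMap A (AdicCompletion I A)))

omit [IsDomain A] in
/-- The maximal ideal of `Â` is `ξÂ`. [folklore] -/
theorem maximalIdeal_eq :
    haveI := isLocalRing hI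
    IsLocalRing.maximalIdeal (AdicCompletion I A) = Ideal.span {xiHat I ξ} := by
  haveI := isLocalRing hI
  rw [← map_eq_span hI]
  exact (IsLocalRing.eq_maximalIdeal (isMaximal_map hI)).symm

omit [IsDomain A] in
/-- An element of `Â` outside `ξÂ` is a unit. [folklore] -/
theorem isUnit_of_not_mem {u : AdicCompletion I A} (hu : u ∉ Ideal.span {xiHat I ξ}) : IsUnit u := by
  haveI := isLocalRing hI
  rw [← maximalIdeal_eq hI] at hu
  exact IsLocalRing.notMem_maximalIdeal.1 hu

omit [IsDomain A] in
/-- A non-unit of `Â` is a multiple of `ξ`. [folklore] -/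
theorem mem_span_of_not_isUnit {u : AdicCompletion I A} (hu : ¬ IsUnit u) : u ∈ Ideal.span {xiHat I ξ} := by
  by_contra h
  exact hu (isUnit_of_not_mem hI h)

omit [IsDomain A] in
/-- `ξ` is not a unit of `Â`. [folklore] -/
theorem not_isUnit_xiHat : ¬ IsUnit (xiHat I ξ) := by
  haveI := isLocalRing hI
  have h : xiHat I ξ ∈ IsLocalRing.maximalIdeal (AdicCompletion I A) := by
    rw [maximalIdeal_eq hI]; exact Ideal.mem_span_singleton_self _
  exact (IsLocalRing.mem_maximalIdeal _).1 h

omit [IsDomain A] in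
/-- **Every nonzero `x ∈ Â` is `ξⁿ · u` with `u` a unit** (`n + 1` = the first level at which `x`
is nonzero). [cite: FontaineAsterisque223III, Exp. II §1.5.2] [cite: FontaineOuyang2022, Prop. 5.1.4] -/
theorem exists_eq_pow_mul {x : AdicCompletion I A} (hx : x ≠ 0) :
    ∃ (n : ℕ) (u : AdicCompletion I A), IsUnit u ∧ x = xiHat I ξ ^ n * u := by
  classical
  have hex : ∃ n, AdicCompletion.evalₐ I n x ≠ 0 := by
    by_contra h
    exact hx (AdicCompletion.ext_evalₐ fun n => by rw [_root_.map_zero]; exact not_not.1 (not_exists.1 h n))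
  have hm : AdicCompletion.evalₐ I (Nat.find hex) x ≠ 0 := Nat.find_spec hex
  have hm0 : Nat.find hex ≠ 0 := fun h0 => hm (by rw [h0]; exact evalₐ_zero_eq x)
  obtain ⟨n, hn⟩ := Nat.exists_eq_succ_of_ne_zero hm0
  have hlt : AdicCompletion.evalₐ I n x = 0 := by
    have := Nat.find_min hex (m := n) (by rw [hn]; exact Nat.lt_succ_self n)
    rwa [not_not] at this
  obtain ⟨u, hu⟩ := (evalₐ_eq_zero_iff hI x n).1 hlt
  refine ⟨n, u, isUnit_of_not_mem hI fun hmem => hm ?_, hu⟩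
  rw [hn]
  obtain ⟨v, hv⟩ := Ideal.mem_span_singleton'.1 hmem
  rw [evalₐ_eq_zero_iff hI]
  exact ⟨v, by rw [hu, ← hv, pow_succ]; ring⟩

/-- **`Â` is an integral domain.** [cite: FontaineOuyang2022, Prop. 5.1.4] -/
theorem isDomain (hξ : ξ ≠ 0) : IsDomain (AdicCompletion I A) := by
  haveI := isLocalRing hI
  refine @NoZeroDivisors.to_isDomain _ _ inferInstance ⟨fun {x y} hxy => ?_⟩
  by_contra h
  rw [not_or] at h
  obtain ⟨a, u, hu, rfl⟩ := exists_eq_pow_mul hI h.1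
  obtain ⟨b, v, hv, rfl⟩ := exists_eq_pow_mul hI h.2
  have h1 : xiHat I ξ ^ (a + b) * (u * v) = 0 := by rw [← hxy]; ring
  exact (hu.mul hv).ne_zero (eq_zero_of_xi_pow_mul_eq_zero hI hξ (a + b) h1)

/-- `ξ ≠ 0` in `Â` (as `ξ ∉ (ξ²)`: `(ξ)` is a proper ideal of the domain `A`). [folklore] -/
theorem xiHat_ne_zero (hξ : ξ ≠ 0) : xiHat I ξ ≠ 0 := fun h => by
  subst hI
  have h1 : AdicCompletion.evalₐ (Ideal.span {ξ}) 2 (xiHat (Ideal.span {ξ}) ξ) = 0 := by rw [h, _root_.map_zero]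
  rw [xiHat, AdicCompletion.evalₐ_of, Ideal.Quotient.eq_zero_iff_mem, Ideal.span_singleton_pow, Ideal.mem_span_singleton'] at h1
  obtain ⟨s, hs⟩ := h1
  have h2 : ξ * (s * ξ) = ξ * 1 := by rw [mul_one]; linear_combination hs
  have h3 := mul_left_cancel₀ hξ h2
  exact hmax.ne_top (Ideal.eq_top_of_isUnit_mem _ (Ideal.mem_span_singleton_self ξ)
    (IsUnit.of_mul_eq_one_right s h3))

/-- **`ξ` is irreducible in `Â`** (a generator of the maximal ideal of a local domain).
[cite: FontaineOuyang2022, Prop. 5.1.4] -/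
theorem irreducible_xiHat (hξ : ξ ≠ 0) : Irreducible (xiHat I ξ) := by
  haveI := isDomain hI hξ
  refine ⟨not_isUnit_xiHat hI, fun a b hab => ?_⟩
  by_contra h
  rw [not_or] at h
  obtain ⟨a', rfl⟩ := Ideal.mem_span_singleton'.1 (mem_span_of_not_isUnit hI h.1)
  obtain ⟨b', rfl⟩ := Ideal.mem_span_singleton'.1 (mem_span_of_not_isUnit hI h.2)
  have h1 : xiHat I ξ * 1 = xiHat I ξ * (xiHat I ξ * (a' * b')) := by
    rw [mul_one]
    calc xiHat I ξ = a' * xiHat I ξ * (b' * xiHat I ξ) := hab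
      _ = xiHat I ξ * (xiHat I ξ * (a' * b')) := by ring
  have h2 := mul_left_cancel₀ (xiHat_ne_zero hI hξ) h1
  exact not_isUnit_xiHat hI (IsUnit.of_mul_eq_one _ h2.symm)

/-- **`Â` is a discrete valuation ring** with uniformizer `ξ`. [cite: FontaineAsterisque223III, Exp. II §1.5.2]
[cite: FontaineOuyang2022, Prop. 5.1.4] -/
theorem isDiscreteValuationRing (hξ : ξ ≠ 0) :
    haveI := isDomain hI hξ
    IsDiscreteValuationRing (AdicCompletion I A) := by
  haveI := isDomain hI hξ
  refine IsDiscreteValuationRing.ofHasUnitMulPowIrreducibleFactorization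
    ⟨xiHat I ξ, irreducible_xiHat hI hξ, fun {x} hx => ?_⟩
  obtain ⟨n, u, hu, rfl⟩ := exists_eq_pow_mul hI hx
  exact ⟨n, hu.unit, by rw [IsUnit.unit_spec]⟩

end Maximal

end PrincipalCompletion

/-! ### Application: `B_dR⁺(F)` -/

open ValuativeRel Field WittVector

open Literature.NumberTheory.GaloisRepresentations
open Literature.NumberTheory.GaloisRepresentations.IsNonarchimedeanLocalField

variable {F : Type} [Field F] [ValuativeRel F] [TopologicalSpace F] [IsNonarchimedeanLocalField F]
  {p : ℕ} [Fact p.Prime] [Fact (¬ IsUnit (p : integerC F))]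

/-- **`𝔸_inf(F)` is an integral domain** (Witt vectors of the domain `𝒪_{ℂ_F}♭`). [folklore] -/
instance instIsDomainAinf : IsDomain (Ainf (p := p) F) := WittVector.instIsDomain

/-- `p ≠ 0` in `𝔸_inf(F)`. [folklore] -/
theorem natCast_ainf_ne_zero : (p : Ainf (p := p) F) ≠ 0 := WittVector.p_nonzero p (PreTilt (integerC F) p)

/-- **`𝔸_inf(F)[1/p]` is an integral domain.** [folklore] -/
instance instIsDomainAwayAinf : IsDomain (Localization.Away (p : Ainf (p := p) F)) :=
  IsLocalization.isDomain_localization (powers_le_nonZeroDivisors_of_noZeroDivisors natCast_ainf_ne_zero)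

/-- `𝔸_inf(F) → 𝔸_inf(F)[1/p]` is injective. [folklore] -/
theorem algebraMap_awayAinf_injective :
    Function.Injective (algebraMap (Ainf (p := p) F) (Localization.Away (p : Ainf (p := p) F))) :=
  IsLocalization.injective _ (powers_le_nonZeroDivisors_of_noZeroDivisors natCast_ainf_ne_zero)

variable [CharZero F] [IsAdicComplete (Ideal.span {(p : integerC F)}) (integerC F)]

omit [IsAdicComplete (Ideal.span {(p : integerC F)}) (integerC F)] in
/-- `ξ ≠ 0` in `𝔸_inf(F)` (its reduction `p♭` is nonzero). [folklore] -/
theorem xi_ne_zero : (xi : Ainf (p := p) F) ≠ 0 := fun h => by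
  have h1 := constantCoeff_xi (F := F) (p := p)
  rw [h, _root_.map_zero] at h1
  exact pFlat_ne_zero h1.symm

omit [IsAdicComplete (Ideal.span {(p : integerC F)}) (integerC F)] in
/-- `ξ ≠ 0` in `𝔸_inf(F)[1/p]`. [folklore] -/
theorem algebraMap_xi_ne_zero :
    algebraMap (Ainf (p := p) F) (Localization.Away (p : Ainf (p := p) F)) xi ≠ 0 := fun h =>
  xi_ne_zero (algebraMap_awayAinf_injective (by rw [h, _root_.map_zero]))

/-- **`B_dR⁺(F)` is an integral domain.** [cite: FontaineAsterisque223III, Exp. II §1.5.2] -/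
theorem isDomain_bDeRhamPlus (hF : Function.Surjective (fontaineTheta (integerC F) p)) :
    IsDomain (BDeRhamPlus (integerC F) p) :=
  haveI := isMaximal_ker_fontaineThetaInvertP hF
  PrincipalCompletion.isDomain ker_fontaineThetaInvertP_eq_span algebraMap_xi_ne_zero

/-- **`B_dR⁺(F)` is a discrete valuation ring.** [cite: FontaineAsterisque223III, Exp. II §1.5.2]
[cite: FontaineOuyang2022, Prop. 5.1.4] -/
theorem isDiscreteValuationRing_bDeRhamPlus (hF : Function.Surjective (fontaineTheta (integerC F) p)) :
    haveI := isDomain_bDeRhamPlus (F := F) (p := p) hF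
    IsDiscreteValuationRing (BDeRhamPlus (integerC F) p) :=
  haveI := isMaximal_ker_fontaineThetaInvertP hF
  PrincipalCompletion.isDiscreteValuationRing ker_fontaineThetaInvertP_eq_span algebraMap_xi_ne_zero

/-- **The image `ξ_dR` of `ξ` in `B_dR⁺(F)`.** [cite: FontaineAsterisque223III, Exp. II §1.5.2] -/
def xiBdR : BDeRhamPlus (integerC F) p :=
  algebraMap (Localization.Away (p : Ainf (p := p) F)) (BDeRhamPlus (integerC F) p)
    (algebraMap (Ainf (p := p) F) (Localization.Away (p : Ainf (p := p) F)) xi)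

/-- **Every nonzero element of `B_dR⁺(F)` is `ξⁿ · unit`.** [cite: FontaineAsterisque223III, Exp. II §1.5.2] -/
theorem exists_eq_xi_pow_mul_bDeRhamPlus (hF : Function.Surjective (fontaineTheta (integerC F) p))
    {x : BDeRhamPlus (integerC F) p} (hx : x ≠ 0) :
    ∃ (n : ℕ) (u : BDeRhamPlus (integerC F) p), IsUnit u ∧ x = xiBdR ^ n * u :=
  haveI := isMaximal_ker_fontaineThetaInvertP hF
  PrincipalCompletion.exists_eq_pow_mul ker_fontaineThetaInvertP_eq_span hx

/-- **The maximal ideal of `B_dR⁺(F)` is `ξ B_dR⁺(F)`** (`= ker` of the extension of `θ`).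
[cite: FontaineAsterisque223III, Exp. II §1.5.2] -/
theorem maximalIdeal_bDeRhamPlus_eq_span (hF : Function.Surjective (fontaineTheta (integerC F) p)) :
    haveI := isLocalRing_bDeRhamPlus (F := F) (p := p) hF
    IsLocalRing.maximalIdeal (BDeRhamPlus (integerC F) p) = Ideal.span {xiBdR} :=
  haveI := isMaximal_ker_fontaineThetaInvertP hF
  PrincipalCompletion.maximalIdeal_eq ker_fontaineThetaInvertP_eq_span

/-- `ξ_dR` is a non-zero-divisor: `ξ_dR x = 0 → x = 0`. [folklore] -/
theorem eq_zero_of_xiBdR_mul_eq_zero {x : BDeRhamPlus (integerC F) p} (h : xiBdR * x = 0) : x = 0 :=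
  PrincipalCompletion.eq_zero_of_xi_mul_eq_zero ker_fontaineThetaInvertP_eq_span algebraMap_xi_ne_zero h

/-! ### Specialisation to `hp : v(p) < 1` -/

/-- **`B_dR⁺(F)` is an integral domain.** [cite: FontaineAsterisque223III, Exp. II §1.5.2] -/
instance instIsDomainBdRPlus (hp : valuation F p < 1) : IsDomain (BdRPlus F hp) := by
  haveI : Fact (¬ IsUnit (p : integerC F)) := ⟨not_isUnit_natCast_integerC hp⟩
  haveI := isAdicComplete_integerC_natCast hp
  exact isDomain_bDeRhamPlus (surjective_fontaineTheta_integerC hp)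

/-- **`B_dR⁺(F)` is a discrete valuation ring.** [cite: FontaineAsterisque223III, Exp. II §1.5.2] -/
instance instIsDiscreteValuationRingBdRPlus (hp : valuation F p < 1) : IsDiscreteValuationRing (BdRPlus F hp) := by
  haveI : Fact (¬ IsUnit (p : integerC F)) := ⟨not_isUnit_natCast_integerC hp⟩
  haveI := isAdicComplete_integerC_natCast hp
  exact isDiscreteValuationRing_bDeRhamPlus (surjective_fontaineTheta_integerC hp)

end Literature.NumberTheory.PAdicHodge

end
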